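import Summits.Parity.GeneralizedHardyLittlewood.Theorems.PrimeLevelFamEdgeMomentsBeyondDiagonalDiagRemRademacher
import Literature.NumberTheory.LFunctions.SiegelWalfiszLiouville
import HarnessLib

/-!
# Route `PrimeLevelFamEdge`, crux K_A `MomentsBeyondDiagonal` (stmt-Parity-20007), line «petersson_layers» v4, stub `stub_diag`:
# **the `t`-deformed Dirichlet rearrangement of the `D₄`-decorated Selberg coefficients** (brick D3b of «D4TAIL»)
# `Σ_{k ≤ N} a_n(k)D₄(k) = Σ_{m ≤ N} Σ_{i ≤ 4} C(4,i)·η_n^{(4−i)}(m)·Σ_{j ≤ N/m} Σ_{de = j} μ(d)μ(e)(log d − log e)ⁱ/(de)`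

The identity behind the `t`-deformation route to «D4TAIL» (`…DiagRemMoebiusLogPow`, module docstring). In `ArithmeticFunction ℝ⟦X⟧`
put `E(d) = e^{X log d}`, `E⁻(d) = e^{−X log d}` (`…DiagRemRademacher`), `GE = (μ/id)·E`, `GE⁻ = (μ/id)·E⁻`, `AE = id⁻¹·E`, `AE⁻ = id⁻¹·E⁻`,
`𝔄_n(k) = W_n(k)·Σ_{de=k}E(d)E⁻(e)` (`W_n = 1_{(·,n)=1}μ/(id·ψ)`). Then `GE ∗ AE = δ = GE⁻ ∗ AE⁻` (complete multiplicativity of `E` and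
`Σ_{d∣k}μ(d) = [k=1]`), so with `B = GE ∗ GE⁻` and `H_n = AE ∗ AE⁻ ∗ 𝔄_n` one has `B ∗ H_n = 𝔄_n` EXACTLY; the `X⁴`-coefficient of
`𝔄_n(k)` is `a_n(k)D₄(k)/4!` (Rademacher), that of `B(j)` is the GOOD kernel `Σ_{de=j}μ(d)μ(e)(log d − log e)ⁱ/(de·i!)` — every one of
whose partial sums converges (`…DiagRemHyperbolaProduct`) — and `η_n^{(c)}(m) = c!·[X^c]H_n(m)` is the explicit triple divisor sum

  `η_n^{(c)}(m) = Σ_{y₁y₂ = m} Σ_{x₁x₂ = y₁} Σ_{z₁z₂ = y₂} x₁⁻¹x₂⁻¹·W_n(y₂)·(log x₁ − log x₂ + log z₁ − log z₂)^c`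

(the `t`-deformed local factor; `η^{(0)} = h_n` of `…KernelFormXSq.hloc`). No individually divergent piece (`Σμ(d)P₄(d)/d`, …) ever appears.

* `GE_mul_AE_eq_one` — `((μ/id)·e^{sX log}) ∗ (id⁻¹·e^{sX log}) = δ` (hypothesis-parametrised, def-free);
* `coeff_B`, `coeff_frakA`, `coeff_H` — the coefficient formulas;
* `sum_copTauW_decorFour_eq_deformed` — **the rearranged identity** (statement purely real: `a_n`, `μ`, `W`, logarithms).

Def-free; theorems only; elementary. Helper `--supports stmt-Parity-20007`; closes nothing; K_A, K_B and the Parity summit are NOT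
proved; nothing about Landau–Siegel zeros.

## References
* E. Kowalski, P. Michel, J. VanderKam, J. reine angew. Math. 526 (2000), Prop. 5.1 p. 18.
  [cite: KowalskiMichelVanderKam2000, Prop. 5.1 — derivation (decorated Selberg coefficients, ν(s)/ζ² factorisation)]
-/

noncomputable section

open Finset Real ArithmeticFunction

namespace Summit.Parity.GeneralizedHardyLittlewood.Theorems.MomentsBeyondDiagonal.DiagCorner

open Literature.NumberTheory.LFunctions.KMV2000.MollifierMainTerm (W G invA)
open Summit.Parity.GeneralizedHardyLittlewood.Theorems.BeyondDiagonalBeatsQuarter.KernelFormXSq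
  (copTauW copTauW_apply G_apply' invA_apply' G_mul_invA)
open Literature.NumberTheory.LFunctions.SiegelWalfiszLiouville (sum_Ioc_sum_divisorsAntidiagonal_eq)
open Literature.Barriers.Parity (Icc_one_eq_Ioc_zero)

/-! ### `GE ∗ AE = δ` -/

/-- Members of a divisors-antidiagonal are nonzero. [folklore] -/
theorem ne_zero_of_mem_divisorsAntidiagonal' {k : ℕ} {x : ℕ × ℕ} (hx : x ∈ k.divisorsAntidiagonal) :
    x.1 ≠ 0 ∧ x.2 ≠ 0 := by
  have hx' := Nat.mem_divisorsAntidiagonal.1 hx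
  exact ⟨fun h ↦ hx'.2 (by rw [← hx'.1, h, zero_mul]), fun h ↦ hx'.2 (by rw [← hx'.1, h, mul_zero])⟩

/-- `e^{sX log d}·e^{sX log e} = e^{sX log(de)}` for `d, e ≥ 1`. [folklore] -/
theorem expWeight_mul_eq_of_mul {s : ℝ} {d e : ℕ} (hd : d ≠ 0) (he : e ≠ 0) :
    PowerSeries.rescale (s * Real.log d) (PowerSeries.exp ℝ) * PowerSeries.rescale (s * Real.log e) (PowerSeries.exp ℝ) =
      PowerSeries.rescale (s * Real.log ((d * e : ℕ) : ℝ)) (PowerSeries.exp ℝ) := by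
  rw [expWeight_mul]
  congr 1
  push_cast
  rw [Real.log_mul (by exact_mod_cast hd) (by exact_mod_cast he)]
  ring

/-- **`((μ/id)·e^{sX log}) ∗ (id⁻¹·e^{sX log}) = δ`** in `ArithmeticFunction ℝ⟦X⟧`: the `t`-deformation of `(μ/id) ∗ id⁻¹ = δ`
(`…KernelFormXSq.G_mul_invA`), by complete multiplicativity of the exponential weight.
[cite: KowalskiMichelVanderKam2000, Prop. 5.1 — derivation (ν(s)/ζ² factorisation)] -/
theorem GE_mul_AE_eq_one (s : ℝ) (GE AE : ArithmeticFunction (PowerSeries ℝ))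
    (hGE : ∀ d : ℕ, GE d = PowerSeries.C (G d) * PowerSeries.rescale (s * Real.log d) (PowerSeries.exp ℝ))
    (hAE : ∀ d : ℕ, AE d = PowerSeries.C ((d : ℝ)⁻¹) * PowerSeries.rescale (s * Real.log d) (PowerSeries.exp ℝ)) :
    GE * AE = 1 := by
  ext k : 1
  rw [mul_apply]
  have hterm : ∀ x ∈ k.divisorsAntidiagonal, GE x.1 * AE x.2 =
      PowerSeries.C (G x.1 * invA x.2) * PowerSeries.rescale (s * Real.log k) (PowerSeries.exp ℝ) := by
    intro x hx
    obtain ⟨h1, h2⟩ := ne_zero_of_mem_divisorsAntidiagonal' hx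
    have hk : x.1 * x.2 = k := (Nat.mem_divisorsAntidiagonal.1 hx).1
    rw [hGE, hAE, invA_apply', map_mul, ← hk, ← expWeight_mul_eq_of_mul h1 h2]
    ring
  rw [Finset.sum_congr rfl hterm, ← Finset.sum_mul, ← map_sum]
  have hconv : ∑ x ∈ k.divisorsAntidiagonal, G x.1 * invA x.2 = (G * invA) k := by rw [mul_apply]
  rw [hconv, G_mul_invA]
  by_cases hk1 : k = 1
  · subst hk1
    simp
  · rw [one_apply_ne hk1, one_apply_ne hk1]
    simp

/-! ### The coefficient formulas -/

/-- `[Xⁱ]B(j) = Σ_{de=j} μ(d)μ(e)/(de)·(log d − log e)ⁱ/i!` for `B = GE ∗ GE⁻`. [folklore] -/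
theorem coeff_B (GE GEm : ArithmeticFunction (PowerSeries ℝ))
    (hGE : ∀ d : ℕ, GE d = PowerSeries.C (G d) * PowerSeries.rescale (1 * Real.log d) (PowerSeries.exp ℝ))
    (hGEm : ∀ d : ℕ, GEm d = PowerSeries.C (G d) * PowerSeries.rescale (-1 * Real.log d) (PowerSeries.exp ℝ)) (j i : ℕ) :
    PowerSeries.coeff i ((GE * GEm) j) =
      ∑ x ∈ j.divisorsAntidiagonal, G x.1 * G x.2 * (Real.log x.1 - Real.log x.2) ^ i / (i.factorial : ℝ) := by
  rw [mul_apply, map_sum]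
  refine Finset.sum_congr rfl fun x _ ↦ ?_
  rw [hGE, hGEm, show PowerSeries.C (G x.1) * PowerSeries.rescale (1 * Real.log x.1) (PowerSeries.exp ℝ) *
      (PowerSeries.C (G x.2) * PowerSeries.rescale (-1 * Real.log x.2) (PowerSeries.exp ℝ)) =
      PowerSeries.C (G x.1 * G x.2) * (PowerSeries.rescale (1 * Real.log x.1) (PowerSeries.exp ℝ) *
        PowerSeries.rescale (-1 * Real.log x.2) (PowerSeries.exp ℝ)) by rw [map_mul]; ring,
    expWeight_mul, PowerSeries.coeff_C_mul, coeff_rescale_exp]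
  rw [mul_div_assoc]
  congr 2; ring

/-- `[X⁴]𝔄_n(k)·4! = a_n(k)·D₄(k)` for `𝔄_n(k) = W_n(k)·Σ_{de=k}E(d)E⁻(e)` (Rademacher).
[cite: KowalskiMichelVanderKam2000, Prop. 5.1 — derivation (decorated Selberg coefficients)] -/
theorem coeff_frakA (n : ℕ) (frakA : ArithmeticFunction (PowerSeries ℝ))
    (hA : ∀ k : ℕ, frakA k = PowerSeries.C (if k.Coprime n then W k else 0) *
      ∑ z ∈ k.divisorsAntidiagonal, PowerSeries.rescale (1 * Real.log z.1) (PowerSeries.exp ℝ) *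
        PowerSeries.rescale (-1 * Real.log z.2) (PowerSeries.exp ℝ)) (k : ℕ) :
    (24 : ℝ) * PowerSeries.coeff 4 (frakA k) =
      copTauW n k * (3 * (∑ p ∈ k.primeFactors, Real.log p ^ 2) ^ 2 - 2 * ∑ p ∈ k.primeFactors, Real.log p ^ 4) := by
  rw [copTauW_mul_decorFour_eq, hA, PowerSeries.coeff_C_mul, map_sum, Finset.mul_sum, Finset.mul_sum, Finset.mul_sum]
  refine Finset.sum_congr rfl fun z _ ↦ ?_
  rw [expWeight_mul, coeff_rescale_exp]
  simp [Nat.factorial]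
  ring

/-- `[X^c]H_n(m)·c! = η_n^{(c)}(m)` for `H_n = AE ∗ AE⁻ ∗ 𝔄_n` — the explicit `t`-deformed local factor (see the module docstring).
[cite: KowalskiMichelVanderKam2000, Prop. 5.1 — derivation (local factors of ν(s))] -/
theorem coeff_H (n : ℕ) (AE AEm frakA : ArithmeticFunction (PowerSeries ℝ))
    (hAE : ∀ d : ℕ, AE d = PowerSeries.C ((d : ℝ)⁻¹) * PowerSeries.rescale (1 * Real.log d) (PowerSeries.exp ℝ))
    (hAEm : ∀ d : ℕ, AEm d = PowerSeries.C ((d : ℝ)⁻¹) * PowerSeries.rescale (-1 * Real.log d) (PowerSeries.exp ℝ))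
    (hA : ∀ k : ℕ, frakA k = PowerSeries.C (if k.Coprime n then W k else 0) *
      ∑ z ∈ k.divisorsAntidiagonal, PowerSeries.rescale (1 * Real.log z.1) (PowerSeries.exp ℝ) *
        PowerSeries.rescale (-1 * Real.log z.2) (PowerSeries.exp ℝ)) (c m : ℕ) :
    (c.factorial : ℝ) * PowerSeries.coeff c ((AE * AEm * frakA) m) =
      ∑ y ∈ m.divisorsAntidiagonal, ∑ x ∈ y.1.divisorsAntidiagonal, ∑ z ∈ y.2.divisorsAntidiagonal,
        (x.1 : ℝ)⁻¹ * (x.2 : ℝ)⁻¹ * (if y.2.Coprime n then W y.2 else 0) *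
          (Real.log x.1 - Real.log x.2 + (Real.log z.1 - Real.log z.2)) ^ c := by
  rw [mul_apply, map_sum, Finset.mul_sum]
  refine Finset.sum_congr rfl fun y _ ↦ ?_
  rw [mul_apply, hA, Finset.sum_mul, map_sum, Finset.mul_sum]
  refine Finset.sum_congr rfl fun x _ ↦ ?_
  rw [hAE, hAEm, Finset.mul_sum, Finset.mul_sum, map_sum, Finset.mul_sum]
  refine Finset.sum_congr rfl fun z _ ↦ ?_
  have hprod : PowerSeries.C ((x.1 : ℝ)⁻¹) * PowerSeries.rescale (1 * Real.log x.1) (PowerSeries.exp ℝ) *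
      (PowerSeries.C ((x.2 : ℝ)⁻¹) * PowerSeries.rescale (-1 * Real.log x.2) (PowerSeries.exp ℝ)) *
      (PowerSeries.C (if y.2.Coprime n then W y.2 else 0) *
        (PowerSeries.rescale (1 * Real.log z.1) (PowerSeries.exp ℝ) * PowerSeries.rescale (-1 * Real.log z.2) (PowerSeries.exp ℝ))) =
      PowerSeries.C ((x.1 : ℝ)⁻¹ * (x.2 : ℝ)⁻¹ * (if y.2.Coprime n then W y.2 else 0)) *
        PowerSeries.rescale (Real.log x.1 - Real.log x.2 + (Real.log z.1 - Real.log z.2)) (PowerSeries.exp ℝ) := by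
    rw [map_mul, map_mul, expWeight_mul]
    have h2 := PowerSeries.exp_mul_exp_eq_exp_add (A := ℝ) (1 * Real.log x.1) (-1 * Real.log x.2)
    have h3 := PowerSeries.exp_mul_exp_eq_exp_add (A := ℝ) (1 * Real.log x.1 + -1 * Real.log x.2)
      (1 * Real.log z.1 + -1 * Real.log z.2)
    have hsum : 1 * Real.log (x.1 : ℝ) + -1 * Real.log x.2 + (1 * Real.log z.1 + -1 * Real.log z.2) =
        Real.log x.1 - Real.log x.2 + (Real.log z.1 - Real.log z.2) := by ring
    rw [hsum] at h3
    rw [← h3, ← h2]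
    ring
  rw [hprod, PowerSeries.coeff_C_mul, coeff_rescale_exp]
  have : (c.factorial : ℝ) ≠ 0 := by positivity
  field_simp

/-! ### The rearranged identity -/

set_option maxHeartbeats 1600000 in
/-- **The `t`-deformed Dirichlet rearrangement of `Σ_{k ≤ N} a_n(k)D₄(k)`** (see the module docstring): for all `n, N`,
`Σ_{k ≤ N} a_n(k)D₄(k) = Σ_{m ≤ N} Σ_{i=0}^{4} C(4,i)·η_n^{(4−i)}(m)·Σ_{j ≤ N/m}Σ_{de=j} (μ(d)/d)(μ(e)/e)(log d − log e)ⁱ`.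
[cite: KowalskiMichelVanderKam2000, Prop. 5.1 — derivation (decorated Selberg coefficients, ν(s)/ζ² factorisation)] -/
theorem sum_copTauW_decorFour_eq_deformed (n N : ℕ) :
    ∑ k ∈ Icc 1 N, copTauW n k *
        (3 * (∑ p ∈ k.primeFactors, Real.log p ^ 2) ^ 2 - 2 * ∑ p ∈ k.primeFactors, Real.log p ^ 4) =
      ∑ m ∈ Icc 1 N, ∑ i ∈ Finset.range 5, (Nat.choose 4 i : ℝ) *
        (∑ y ∈ m.divisorsAntidiagonal, ∑ x ∈ y.1.divisorsAntidiagonal, ∑ z ∈ y.2.divisorsAntidiagonal,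
          (x.1 : ℝ)⁻¹ * (x.2 : ℝ)⁻¹ * (if y.2.Coprime n then W y.2 else 0) *
            (Real.log x.1 - Real.log x.2 + (Real.log z.1 - Real.log z.2)) ^ (4 - i)) *
        ∑ j ∈ Icc 1 (N / m), ∑ x ∈ j.divisorsAntidiagonal,
          G x.1 * G x.2 * (Real.log x.1 - Real.log x.2) ^ i := by
  classical
  -- the deformed objects
  set GE : ArithmeticFunction (PowerSeries ℝ) :=
    ⟨fun d ↦ PowerSeries.C (G d) * PowerSeries.rescale (1 * Real.log d) (PowerSeries.exp ℝ), by simp⟩ with hGEdef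
  set GEm : ArithmeticFunction (PowerSeries ℝ) :=
    ⟨fun d ↦ PowerSeries.C (G d) * PowerSeries.rescale (-1 * Real.log d) (PowerSeries.exp ℝ), by simp⟩ with hGEmdef
  set AE : ArithmeticFunction (PowerSeries ℝ) :=
    ⟨fun d ↦ PowerSeries.C ((d : ℝ)⁻¹) * PowerSeries.rescale (1 * Real.log d) (PowerSeries.exp ℝ), by simp⟩ with hAEdef
  set AEm : ArithmeticFunction (PowerSeries ℝ) :=
    ⟨fun d ↦ PowerSeries.C ((d : ℝ)⁻¹) * PowerSeries.rescale (-1 * Real.log d) (PowerSeries.exp ℝ), by simp⟩ with hAEmdef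
  set frakA : ArithmeticFunction (PowerSeries ℝ) :=
    ⟨fun k ↦ PowerSeries.C (if k.Coprime n then W k else 0) *
      ∑ z ∈ k.divisorsAntidiagonal, PowerSeries.rescale (1 * Real.log z.1) (PowerSeries.exp ℝ) *
        PowerSeries.rescale (-1 * Real.log z.2) (PowerSeries.exp ℝ), by simp⟩ with hAdef
  have hGE : ∀ d : ℕ, GE d = PowerSeries.C (G d) * PowerSeries.rescale (1 * Real.log d) (PowerSeries.exp ℝ) := fun d ↦ rfl
  have hGEm : ∀ d : ℕ, GEm d = PowerSeries.C (G d) * PowerSeries.rescale (-1 * Real.log d) (PowerSeries.exp ℝ) := fun d ↦ rfl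
  have hAE : ∀ d : ℕ, AE d = PowerSeries.C ((d : ℝ)⁻¹) * PowerSeries.rescale (1 * Real.log d) (PowerSeries.exp ℝ) := fun d ↦ rfl
  have hAEm : ∀ d : ℕ, AEm d = PowerSeries.C ((d : ℝ)⁻¹) * PowerSeries.rescale (-1 * Real.log d) (PowerSeries.exp ℝ) :=
    fun d ↦ rfl
  have hA : ∀ k : ℕ, frakA k = PowerSeries.C (if k.Coprime n then W k else 0) *
      ∑ z ∈ k.divisorsAntidiagonal, PowerSeries.rescale (1 * Real.log z.1) (PowerSeries.exp ℝ) *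
        PowerSeries.rescale (-1 * Real.log z.2) (PowerSeries.exp ℝ) := fun k ↦ rfl
  -- `B ∗ H = 𝔄`
  have h1 : GE * AE = 1 := GE_mul_AE_eq_one 1 GE AE hGE hAE
  have h2 : GEm * AEm = 1 := GE_mul_AE_eq_one (-1) GEm AEm hGEm hAEm
  have hBH : (AE * AEm * frakA) * (GE * GEm) = frakA := by
    calc (AE * AEm * frakA) * (GE * GEm) = (GE * AE) * (GEm * AEm) * frakA := by ring
      _ = frakA := by rw [h1, h2, one_mul, one_mul]
  have hBi : ∀ j i : ℕ, (i.factorial : ℝ) * PowerSeries.coeff i ((GE * GEm) j) =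
      ∑ x ∈ j.divisorsAntidiagonal, G x.1 * G x.2 * (Real.log x.1 - Real.log x.2) ^ i := by
    intro j i
    rw [coeff_B GE GEm hGE hGEm j i, Finset.mul_sum]
    refine Finset.sum_congr rfl fun x _ ↦ ?_
    have : (i.factorial : ℝ) ≠ 0 := by positivity
    field_simp
  -- pointwise in `k`: `a_n(k)D₄(k) = Σ_{mj=k} Σ_i C(4,i)·η^{(4−i)}(m)·[i!·Xⁱ-coefficient of B(j)]`
  have hpt : ∀ k : ℕ, copTauW n k *
      (3 * (∑ p ∈ k.primeFactors, Real.log p ^ 2) ^ 2 - 2 * ∑ p ∈ k.primeFactors, Real.log p ^ 4) =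
      ∑ y ∈ k.divisorsAntidiagonal, ∑ i ∈ Finset.range 5, (Nat.choose 4 i : ℝ) *
        (((4 - i).factorial : ℝ) * PowerSeries.coeff (4 - i) ((AE * AEm * frakA) y.1)) *
          ((i.factorial : ℝ) * PowerSeries.coeff i ((GE * GEm) y.2)) := by
    intro k
    rw [← coeff_frakA n frakA hA k, show frakA k = ((AE * AEm * frakA) * (GE * GEm)) k by rw [hBH], mul_apply, map_sum,
      Finset.mul_sum]
    refine Finset.sum_congr rfl fun y _ ↦ ?_
    rw [coeff_mul_four]
    simp only [Finset.sum_range_succ, Finset.sum_range_zero, zero_add, Nat.choose, Nat.factorial,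
      show (4 : ℕ) - 0 = 4 from rfl, show (4 : ℕ) - 1 = 3 from rfl, show (4 : ℕ) - 2 = 2 from rfl,
      show (4 : ℕ) - 3 = 1 from rfl, show (4 : ℕ) - 4 = 0 from rfl]
    push_cast
    ring
  -- sum over `k ≤ N` and pass to `(m, j ≤ N/m)`
  rw [Finset.sum_congr rfl fun k _ ↦ hpt k, Icc_one_eq_Ioc_zero]
  rw [sum_Ioc_sum_divisorsAntidiagonal_eq (fun m j ↦ ∑ i ∈ Finset.range 5, (Nat.choose 4 i : ℝ) *
        (((4 - i).factorial : ℝ) * PowerSeries.coeff (4 - i) ((AE * AEm * frakA) m)) *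
          ((i.factorial : ℝ) * PowerSeries.coeff i ((GE * GEm) j))) N, ← Icc_one_eq_Ioc_zero]
  refine Finset.sum_congr rfl fun m _ ↦ ?_
  rw [← Icc_one_eq_Ioc_zero, Finset.sum_comm]
  refine Finset.sum_congr rfl fun i _ ↦ ?_
  rw [Finset.mul_sum]
  refine Finset.sum_congr rfl fun j _ ↦ ?_
  rw [coeff_H n AE AEm frakA hAE hAEm hA (4 - i) m, hBi j i]

end Summit.Parity.GeneralizedHardyLittlewood.Theorems.MomentsBeyondDiagonal.DiagCorner

end
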